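import Mathlib.RingTheory.PowerSeries.Order
import Mathlib.RingTheory.PowerSeries.Inverse
import Mathlib.RingTheory.DiscreteValuationRing.Basic
import Mathlib.RingTheory.LocalRing.ResidueField.Basic
import HarnessLib

/-!
# Route `AdditiveKolyvaginRoad`, crux KS′ `LevelKolyvaginSystemsAdditive` (item stmt-BirchSwinnertonDyer-21396): THE GREENBERG–VATSAL
# PIN — equal residual order, `μ = 0` and ONE rational one-sided divisibility force two power series over a DVR to generate the same
# ideal (the (RT3-alg) step `GVPinning` of crux-idea card `residual-bdp-transport`, typed there as «pure Mathlib, TRUE and provable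
# now — size S»; cell `pub/bsd-wall`, width seat `bsd-wall-akr-p2x-w2` g8; `--supports stmt-BirchSwinnertonDyer-21396`, helper)

THEOREMS ONLY (no definition, no named fact, no `sorry`); pure commutative algebra, no elliptic curve in the statements.  BSD is
not proved by any of this; KS′/KPA′ stay OPEN.

THE POINT.  Every «transport of a main conjecture along a congruence» argument (Greenberg–Vatsal 2000 for the cyclotomic main
conjecture of congruent elliptic curves; Emerton–Pollack–Weston; the crux-idea cards `residual-bdp-transport` ∕ `bdp-rebase` of this
crux, which transport the anticyclotomic BDP–Greenberg invariants ACROSS THE ADDITIVE PRIME from a `p`-good avatar) ends with the same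
pin: in `Λ = 𝒪⟦T⟧` over a DVR `𝒪` (there `𝒪 = ℤ_p^{ur}`), if the algebraic side `F` has `μ(F) = 0`, the analytic side `G` has the SAME
residual order (`λ(F) = λ(G)`, read as the `T`-adic orders of the reductions mod `ϖ`), and ONE rational one-sided divisibility
`F ∣ ϖ^a·G` holds (an inclusion in `Λ ⊗ ℚ`, either direction of the main conjecture up to a power of `p`), then `(F) = (G)`.  The card
(`Cruxes/LevelKolyvaginSystemsAdditive/ResidualBdpTransportSketch.lean`, def `GVPinning`) types exactly this and says «no Weierstrass
preparation needed»; indeed the proof below is an induction on `a`: for `a ≥ 1` reduce mod `ϖ` — `F̄·H̄ = 0` in the domain `k⟦T⟧` with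
`F̄ ≠ 0` gives `H̄ = 0`, so `H = ϖ·H₁` coefficientwise (`𝔪 = (ϖ)`) and `ϖ` cancels; for `a = 0`, `ord Ḡ = ord F̄ + ord H̄` forces
`ord H̄ = 0`, so `H(0) ∉ 𝔪` and `H` is a unit of `𝒪⟦T⟧`.

* §1 `exists_C_mul_of_map_residue_eq_zero` — a power series over a DVR whose reduction mod `ϖ` vanishes is `C ϖ * H₁`.
* §1 `isUnit_of_order_map_residue_eq_zero` — a power series whose reduction has `T`-adic order `0` is a unit.
* §2 `associated_of_order_map_residue_eq_of_mul_eq` — THE PIN: `F̄ ≠ 0`, `ord F̄ = ord Ḡ`, `C(ϖ^a)·G = F·H` ⟹ `Associated F G`.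
* §2 `gvPinning` — the card's `GVPinning` statement VERBATIM (with `algebraMap 𝒪 𝒪⟦T⟧ (ϖ^a)`), so a line citing the card's
  (RT3-alg) input consumes this theorem by name.

Placement note: pure commutative algebra of the same kind as `Literature.NumberTheory.EllipticCurves.IwasawaTransfer`
(`IwasawaDivisibilityTransfer.lean`: four-term transfer, divisibility sandwich, `μ = 0` descent); landed here as the helper the crux card
asks for — a librarian may re-home it next to that file without change.

References (locators only): [cite: GreenbergVatsal2000, §1, Thms. (1.3)–(1.4) and their proofs (Kato's one-sided divisibility + equality of the
λ- and μ-invariants ⟹ the main conjecture)] [cite: EmertonPollackWeston2006, §3 (algebraic and analytic λ-, μ-invariants across a Hida family)]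
[cite: Washington1997, §7.1 (Λ = 𝒪⟦T⟧, distinguished polynomials, λ and μ; units of Λ)].
-/

-- single-conjunct summit: `Summit.BirchSwinnertonDyer.BirchSwinnertonDyer.…` repeats the name by design
set_option linter.dupNamespace false

set_option autoImplicit false

noncomputable section

open scoped Classical

namespace Summit.BirchSwinnertonDyer.BirchSwinnertonDyer.Theorems.AdditiveKoly.GreenbergVatsalPin

open PowerSeries IsLocalRing

variable {𝒪 : Type*} [CommRing 𝒪] [IsDomain 𝒪] [IsDiscreteValuationRing 𝒪]

/-! ## §1 Two bookkeeping lemmas over a DVR -/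

/-- **A power series over a DVR with vanishing reduction is divisible by the uniformiser**: if `map (residue 𝒪) H = 0` then
`H = C ϖ * H₁` for some `H₁` (coefficientwise: every coefficient lies in `𝔪 = (ϖ)`). [cite: Washington1997, §7.1 (μ-invariant)] -/
theorem exists_C_mul_of_map_residue_eq_zero {ϖ : 𝒪} (hϖ : Irreducible ϖ) {H : PowerSeries 𝒪}
    (hH : PowerSeries.map (residue 𝒪) H = 0) : ∃ H₁ : PowerSeries 𝒪, H = C ϖ * H₁ := by
  have hmax : maximalIdeal 𝒪 = Ideal.span {ϖ} := (IsDiscreteValuationRing.irreducible_iff_uniformizer ϖ).mp hϖ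
  have hcoef : ∀ n : ℕ, ∃ c : 𝒪, coeff n H = ϖ * c := by
    intro n
    have h0 : residue 𝒪 (coeff n H) = 0 := by
      have h := congrArg (coeff n) hH
      rwa [coeff_map, map_zero] at h
    have hmem : coeff n H ∈ maximalIdeal 𝒪 := (residue_eq_zero_iff _).mp h0
    rw [hmax, Ideal.mem_span_singleton'] at hmem
    obtain ⟨c, hc⟩ := hmem
    exact ⟨c, by rw [← hc, mul_comm]⟩
  choose c hc using hcoef
  refine ⟨PowerSeries.mk c, ?_⟩
  ext n
  rw [coeff_C_mul, coeff_mk, hc]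

/-- **A power series over a local ring whose reduction has `T`-adic order `0` is a unit**: its constant coefficient is not in `𝔪`.
[cite: Washington1997, §7.1 (units of Λ = power series with unit constant term)] -/
theorem isUnit_of_order_map_residue_eq_zero {H : PowerSeries 𝒪}
    (hH : (PowerSeries.map (residue 𝒪) H).order = 0) : IsUnit H := by
  have hne : PowerSeries.map (residue 𝒪) H ≠ 0 := by
    intro h0
    rw [h0, order_zero] at hH
    exact ENat.top_ne_zero hH
  have hc : coeff 0 (PowerSeries.map (residue 𝒪) H) ≠ 0 := by
    have h := coeff_order hne
    rwa [hH, ENat.toNat_zero] at h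
  rw [coeff_map, coeff_zero_eq_constantCoeff_apply] at hc
  exact isUnit_iff_constantCoeff.mpr ((residue_ne_zero_iff_isUnit _).mp hc)

/-! ## §2 The pin -/

/-- **THE GREENBERG–VATSAL PIN.**  Over a DVR `𝒪` with a uniformiser `ϖ` (`Irreducible ϖ`): if `F, G, H ∈ 𝒪⟦T⟧` and `a ∈ ℕ`
satisfy `F̄ := map (residue 𝒪) F ≠ 0` (`μ(F) = 0`), `ord_T F̄ = ord_T Ḡ` (equal residual `λ`-invariants) and `C(ϖ^a)·G = F·H`
(`F ∣ ϖ^a G`, one rational one-sided divisibility), then `F` and `G` are ASSOCIATED (generate the same ideal of `𝒪⟦T⟧`).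
Proof by induction on `a` (no Weierstrass preparation): `a = 0` — `ord Ḡ = ord F̄ + ord H̄` in the domain `k⟦T⟧`, all finite, so
`ord H̄ = 0` and `H` is a unit; `a + 1` — reducing mod `ϖ` gives `F̄·H̄ = 0` with `F̄ ≠ 0`, so `H̄ = 0`, `H = ϖ·H₁`, and `ϖ` cancels in
the domain `𝒪⟦T⟧`. [cite: GreenbergVatsal2000, §1, Thms. (1.3)–(1.4) and their proofs]
[cite: EmertonPollackWeston2006, §3] -/
theorem associated_of_order_map_residue_eq_of_mul_eq {ϖ : 𝒪} (hϖ : Irreducible ϖ) (a : ℕ) :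
    ∀ (F G H : PowerSeries 𝒪),
      PowerSeries.map (residue 𝒪) F ≠ 0 →
      (PowerSeries.map (residue 𝒪) F).order = (PowerSeries.map (residue 𝒪) G).order →
      C (ϖ ^ a) * G = F * H → Associated F G := by
  induction a with
  | zero =>
    intro F G H hF hord hGFH
    rw [pow_zero, map_one, one_mul] at hGFH
    -- `Ḡ = F̄ · H̄`, all orders finite, hence `ord H̄ = 0`
    have hG : PowerSeries.map (residue 𝒪) G =
        PowerSeries.map (residue 𝒪) F * PowerSeries.map (residue 𝒪) H := by
      rw [hGFH, map_mul]
    have hfin : (PowerSeries.map (residue 𝒪) F).order ≠ ⊤ := by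
      rwa [ne_eq, order_eq_top]
    obtain ⟨n, hn⟩ := ENat.ne_top_iff_exists.mp hfin
    have h1 := hord
    rw [hG, order_mul, ← hn] at h1
    -- `h1 : n = n + ord H̄` in `ℕ∞`
    have hHfin : (PowerSeries.map (residue 𝒪) H).order ≠ ⊤ := by
      intro htop
      rw [htop, add_top] at h1
      exact ENat.coe_ne_top n h1
    obtain ⟨m, hm⟩ := ENat.ne_top_iff_exists.mp hHfin
    rw [← hm, ← Nat.cast_add] at h1
    have h3 : n = n + m := by exact_mod_cast h1
    have hm0 : m = 0 := by omega
    have hordH : (PowerSeries.map (residue 𝒪) H).order = 0 := by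
      rw [← hm, hm0, Nat.cast_zero]
    obtain ⟨u, hu⟩ := isUnit_of_order_map_residue_eq_zero hordH
    exact ⟨u, by rw [hu, hGFH]⟩
  | succ a ih =>
    intro F G H hF hord hGFH
    -- reduce mod `ϖ`: `0 = F̄ · H̄`, so `H̄ = 0`
    have hH0 : PowerSeries.map (residue 𝒪) H = 0 := by
      have h := congrArg (PowerSeries.map (residue 𝒪)) hGFH
      have hϖa : residue 𝒪 (ϖ ^ (a + 1)) = 0 := by
        have hϖm : ϖ ∈ maximalIdeal 𝒪 := (IsLocalRing.mem_maximalIdeal ϖ).mpr hϖ.not_isUnit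
        rw [map_pow, (residue_eq_zero_iff _).mpr hϖm, zero_pow (Nat.succ_ne_zero a)]
      rw [map_mul, map_mul, map_C, hϖa, map_zero, zero_mul] at h
      -- `0 = F̄ * H̄`
      rcases mul_eq_zero.mp h.symm with h' | h'
      · exact absurd h' hF
      · exact h'
    obtain ⟨H₁, hH₁⟩ := exists_C_mul_of_map_residue_eq_zero hϖ hH0
    -- cancel `ϖ`
    have hCϖ : (C ϖ : PowerSeries 𝒪) ≠ 0 := by
      intro h0
      apply hϖ.ne_zero
      have : (C ϖ : PowerSeries 𝒪) = C 0 := by rw [h0, map_zero]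
      exact C_injective this
    have hGFH' : C (ϖ ^ a) * G = F * H₁ := by
      apply mul_left_cancel₀ hCϖ
      calc C ϖ * (C (ϖ ^ a) * G) = C (ϖ ^ (a + 1)) * G := by rw [pow_succ, map_mul]; ring
        _ = F * H := hGFH
        _ = C ϖ * (F * H₁) := by rw [hH₁]; ring
    exact ih F G H₁ hF hord hGFH'

-- the binders `[IsDomain 𝒪] [IsDiscreteValuationRing 𝒪]` below are the card's `GVPinning` VERBATIM (Mathlib's DVR class takes
-- `IsDomain` as a parameter), hence the overlapping-instances linter is silenced for this one statement
set_option linter.overlappingInstances false in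
/-- **The card's `GVPinning` VERBATIM** (crux-idea card `residual-bdp-transport`, (RT3-alg); `Cruxes/…/ResidualBdpTransportSketch.lean`
def `GVPinning`, with `algebraMap 𝒪 𝒪⟦T⟧ (ϖ^a)` for the constant): over ANY DVR `𝒪` and ANY uniformiser `ϖ`, `F̄ ≠ 0`,
`ord F̄ = ord Ḡ` and `algebraMap 𝒪 𝒪⟦T⟧ (ϖ^a) · G = F · H` imply `Associated F G`.  So the (RT3-alg) input of that card (and of every
Greenberg–Vatsal-type transport on this crux) is a THEOREM, by name. [cite: GreenbergVatsal2000, §1, Thms. (1.3)–(1.4) and their proofs]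
[cite: EmertonPollackWeston2006, §3] -/
theorem gvPinning :
    ∀ (𝒪 : Type) [CommRing 𝒪] [IsDomain 𝒪] [IsDiscreteValuationRing 𝒪] (ϖ : 𝒪), Irreducible ϖ →
      ∀ (F G H : PowerSeries 𝒪) (a : ℕ),
        PowerSeries.map (IsLocalRing.residue 𝒪) F ≠ 0 →
        (PowerSeries.map (IsLocalRing.residue 𝒪) F).order = (PowerSeries.map (IsLocalRing.residue 𝒪) G).order →
        algebraMap 𝒪 (PowerSeries 𝒪) (ϖ ^ a) * G = F * H →
        Associated F G := by
  intro 𝒪 _ _ _ ϖ hϖ F G H a hF hord h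
  rw [← C_eq_algebraMap] at h
  exact associated_of_order_map_residue_eq_of_mul_eq hϖ a F G H hF hord h

end Summit.BirchSwinnertonDyer.BirchSwinnertonDyer.Theorems.AdditiveKoly.GreenbergVatsalPin

end
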